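import Mathlib
import HarnessLib
import Literature.Combinatorics.Additive.KempermanScherk

/-!
# Olson's theorems on the product `A·B` of two finite sets in an arbitrary group
# (Olson 1984, Theorems 1, 2, 3, 5, 6 and the Corollary)

Topic `Literature/Combinatorics/Additive`.  Cell `mm-stpp` (D-0046), seat `mm-stpp-lit` (gen 12);
companion of `KempermanScherk.lean` (Olson's Theorem 4 = Kemperman's unique-representation
theorem, which is used here) and of `Chowla.lean` (`olson_card_add`: the ABELIAN case of Theorem 1,
via Kneser).  Everything in this file is PROVED (no named facts), for an ARBITRARY group `G`
written multiplicatively (Olson writes his possibly non-abelian groups additively: his `A + B`,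
`A + d`, `d + B`, `−A + A`, `B − B` are `A * B`, `A.image (· * d)`, `B.image (d * ·)`, `A⁻¹ * A`,
`B * B⁻¹` here); every statement is also transported to additive notation (`AddGroup`) by
`@[to_additive]` (names: `mul → add`, `inv → neg`, `pow → nsmul`, `Subgroup → AddSubgroup`;
`exists_kemperman_addTransform`, `exists_addTerminal_pair`).

J. E. Olson, *On the sum of two sets in a group*, J. Number Theory 18 (1984) 110–120:

**Theorem 3 (Kemperman's transformation).**  "Let `A` and `B` be two finite sets in a group `G`.
Assume that there is an element `d ∈ −A + A ∩ B − B` such that either `A + d ≠ A` or `d + B ≠ B`.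
Then one can construct two sets `A₁` and `B₁` in `G` satisfying (i) `A₁ + B₁ ⊆ A + B`, and
(ii) either `|A₁| + |B₁| = |A| + |B|` and `|A₁| > |A|`, or `|A₁| + |B₁| > |A| + |B|`." —
`Olson.exists_kemperman_transform` (the two candidates `(A ∪ Ad, B ∩ d⁻¹B)` and
`(A ∩ Ad⁻¹, B ∪ dB)`, as printed; both new sets non-empty).

**Theorem 2.**  "If `C = A + B`, where `A` and `B` are finite subsets in a group `G`, then there is a
subset `S` of `C` and a subgroup `H` of `G` such that `|S| ≥ |A| + |B| − |H|`, and either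
`H + S = S` or `S + H = S`." — `Olson.exists_subset_finsetSubgroup` (`H` as a finite set containing
`1`, closed under `*` and `⁻¹`, with `H * S = S ∨ S * H = S`; `S ≠ ∅`) and
`Olson.exists_subset_subgroup` (`H : Subgroup G`, finite, `#A + #B ≤ #S + Nat.card H`).  Proof as
printed (§3): iterate the transformation while possible (`Olson.exists_terminal_pair`, the
lexicographic potential `(|A| + |B|, |A|)` bounded by `|C|`), and for the terminal pair `(E, F)`:
if `|E| ≥ |F|` and `FF⁻¹ ⊄ E⁻¹E` two right translates of `E` inside `EF` are disjoint and `H = {1}`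
does it; if `FF⁻¹ ⊆ E⁻¹E` every `d ∈ FF⁻¹` fixes `F` on the left and `H = F⁻¹F` is a subgroup with
`EF·H = EF`, `|H| ≥ |F|` (Olson takes the conjugate `−z + D + z` of `D = F − F`; when `F = D + z`
this is the same set `F⁻¹F`, and the kernel proof needs neither the coset structure of `F` nor
`|H| = |F|`); symmetrically for `|E| < |F|` with `H = EE⁻¹`.

**Theorem 1.**  "Let `C = A + B`, where `A` and `B` are finite subsets of a group `G` and `0 ∈ B`.
Then either `C + B = C` or `|C| ≥ |A| + ½|B|`." — `Olson.mul_right_eq_or_card_le`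
(`1 ∈ B → A * B * B = A * B ∨ 2 * #A + #B ≤ 2 * #(A * B)`).  Proof as printed (§4): induction on
`|C|`; Theorem 2 gives `S, H`; Case 1 `S + B = S` (split `A = (A ∩ S) ⊔ (A ∖ S)`, induction on
`(A ∖ S) + B`), Case 2 (`S + b₀ ≠ S`; inequality (6) `|S ∪ (S + b₀)| ≥ |S| + |H|` from the coset
structure when `H + S = S`, resp. from Kemperman's Theorem 4
(`kemperman_card_add_card_le_of_unique_mul`, tree) applied to `S + (H ∪ {b₀})` when `S + H = S`;
then the counts (7)–(10)).

**Theorem 5.**  "Let `C = A + B`, where `A` and `B` are finite sets in a group.  Then either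
`C + (−B + B) = C` or `|C| ≥ |A| + ½|B|`." — `Olson.mul_inv_mul_eq_or_card_le`.
**Corollary.**  "If `A` is a finite set in a group, then either `|A − A| ≥ (3/2)|A|` or `A − A` is
a subgroup." — `Olson.mul_inv_eq_or_card_le` (`A * A⁻¹ * (A * A⁻¹) = A * A⁻¹ ∨ 3#A ≤ 2#(A * A⁻¹)`)
with `Olson.exists_subgroup_coe_eq_mul_inv` (in the first case `A A⁻¹` is the carrier of a
subgroup).  (Mathlib's `Finset.doubling_lt_three_halves` / very-small-doubling file treats
`|A·A| < (3/2)|A|`; the statement here is Olson's, on `A A⁻¹`.)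

**Theorem 6.**  "If `B` is a finite set in a group and `n ≥ 2`, then either `|nB| = |(n+1)B|` or
`|nB| ≥ |(n−1)B| + ½|B|`." — `Olson.card_pow_eq_or_card_le` (form `n = m + 1`) and
`Olson.card_pow_eq_or_card_le'` (as printed).  Proof as printed, except that the subgroup
`H = ⟨−B + B⟩` of (14) is replaced by the set `B⁻¹B` itself: the set `(b₁⁻¹b₂ Bⁿ) ∖ Bⁿ` of (16) is
non-empty and stable under right multiplication by `B⁻¹B`, hence already has `≥ |B⁻¹B| ≥ |B|`
elements, which is all that (17)–(18) use.

NOT FORMALIZED: §5 (the examples showing `S = C` is impossible in Theorem 2; Diderrich's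
conjecture), the closing remarks after Theorem 6 (the structure of `nB` when `|nB| = |(n+1)B|`).
Olson's Theorem 4 is `kemperman_card_add_card_le_of_unique_mul` in `KempermanScherk.lean`.
Census-silent for the cell `mm-stpp` (LIT-INDEX §11 (f): print menu for non-abelian hosts).

## References
* J. E. Olson, *On the sum of two sets in a group*, J. Number Theory 18 (1984) 110–120 — held
  `paper:doi-10-1016-0022-314x-84-90047-7`, pp. 110–120 read in full 2026-08-28
  [cite: Olson1984, Thm 1; Thm 2; Thm 3; Thm 5; Cor; Thm 6].
* J. H. B. Kemperman, *On complexes in a semigroup*, Indag. Math. 18 (1956) 247–254 (the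
  transformation and Theorem 4; through `KempermanScherk.lean`) [cite: Kemperman1956, Thm 3].
-/

namespace Literature.Combinatorics.Additive

open Finset
open scoped Pointwise

variable {G : Type*} [Group G] [DecidableEq G]

namespace Olson

/-! ### Kemperman's transformation (Olson 1984, Thm 3) -/

/-- Bookkeeping for Kemperman's transformation: `|A ∪ Ad| + |{a ∈ A : ad ∈ A}| = 2|A|` (the
`p` of Olson's proof is `|Ad ∖ A| = |A ∪ Ad| − |A| = |A| − |A ∩ Ad⁻¹|`). [cite: Olson1984, Thm 3 (proof)] -/
@[to_additive /-- Additive-notation version (Olson writes his groups additively; statement and sources as for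
the multiplicative declaration, Olson 1984). -/]
theorem card_union_mulRight_add_card_filter (A : Finset G) (d : G) :
    #(A ∪ A.image (· * d)) + #(A.filter (fun a => a * d ∈ A)) = #A + #A := by
  have hI : A ∩ A.image (· * d) = (A.filter (fun a => a * d ∈ A)).image (· * d) := by
    ext x
    simp only [mem_inter, mem_image, mem_filter]
    constructor
    · rintro ⟨hx, a, ha, rfl⟩
      exact ⟨a, ⟨ha, hx⟩, rfl⟩
    · rintro ⟨a, ⟨ha, had⟩, rfl⟩
      exact ⟨had, a, ha, rfl⟩
  have h1 := card_union_add_card_inter A (A.image (· * d))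
  rw [hI, card_image_of_injective _ (mul_left_injective d),
    card_image_of_injective _ (mul_left_injective d)] at h1
  exact h1

/-- Bookkeeping for Kemperman's transformation: `|B ∪ dB| + |{b ∈ B : db ∈ B}| = 2|B|` (the `q`
of Olson's proof). [cite: Olson1984, Thm 3 (proof)] -/
@[to_additive /-- Additive-notation version (Olson writes his groups additively; statement and sources as for
the multiplicative declaration, Olson 1984). -/]
theorem card_union_mulLeft_add_card_filter (B : Finset G) (d : G) :
    #(B ∪ B.image (d * ·)) + #(B.filter (fun b => d * b ∈ B)) = #B + #B := by
  have hI : B ∩ B.image (d * ·) = (B.filter (fun b => d * b ∈ B)).image (d * ·) := by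
    ext x
    simp only [mem_inter, mem_image, mem_filter]
    constructor
    · rintro ⟨hx, b, hb, rfl⟩
      exact ⟨b, ⟨hb, hx⟩, rfl⟩
    · rintro ⟨b, ⟨hb, hdb⟩, rfl⟩
      exact ⟨hdb, b, hb, rfl⟩
  have h1 := card_union_add_card_inter B (B.image (d * ·))
  rw [hI, card_image_of_injective _ (mul_right_injective d),
    card_image_of_injective _ (mul_right_injective d)] at h1
  exact h1

/-- Theorem 3 (i) for the first candidate pair: `(A ∪ Ad)·(B ∩ d⁻¹B) ⊆ A·B`.
[cite: Olson1984, Thm 3 (i)] -/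
@[to_additive /-- Additive-notation version (Olson writes his groups additively; statement and sources as for
the multiplicative declaration, Olson 1984). -/]
theorem union_mulRight_mul_filter_subset (A B : Finset G) (d : G) :
    (A ∪ A.image (· * d)) * (B.filter (fun b => d * b ∈ B)) ⊆ A * B := by
  intro x hx
  obtain ⟨u, hu, v, hv, rfl⟩ := mem_mul.1 hx
  rw [mem_filter] at hv
  rcases mem_union.1 hu with huA | huI
  · exact mem_mul.2 ⟨u, huA, v, hv.1, rfl⟩
  · obtain ⟨a, ha, rfl⟩ := mem_image.1 huI
    exact mem_mul.2 ⟨a, ha, d * v, hv.2, by simp only [mul_assoc]⟩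

/-- Theorem 3 (i) for the second candidate pair: `(A ∩ Ad⁻¹)·(B ∪ dB) ⊆ A·B`.
[cite: Olson1984, Thm 3 (i)] -/
@[to_additive /-- Additive-notation version (Olson writes his groups additively; statement and sources as for
the multiplicative declaration, Olson 1984). -/]
theorem filter_mul_union_mulLeft_subset (A B : Finset G) (d : G) :
    (A.filter (fun a => a * d ∈ A)) * (B ∪ B.image (d * ·)) ⊆ A * B := by
  intro x hx
  obtain ⟨u, hu, v, hv, rfl⟩ := mem_mul.1 hx
  rw [mem_filter] at hu
  rcases mem_union.1 hv with hvB | hvI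
  · exact mem_mul.2 ⟨u, hu.1, v, hvB, rfl⟩
  · obtain ⟨b, hb, rfl⟩ := mem_image.1 hvI
    exact mem_mul.2 ⟨u * d, hu.2, b, hb, by simp only [mul_assoc]⟩

/-- `Ad = A` iff `{a ∈ A : ad ∈ A} = A`. [folklore] -/
@[to_additive]
private theorem filter_mulRight_eq_self_iff (A : Finset G) (d : G) :
    A.filter (fun a => a * d ∈ A) = A ↔ A.image (· * d) = A := by
  constructor
  · intro h
    apply eq_of_subset_of_card_le
    · intro x hx
      obtain ⟨a, ha, rfl⟩ := mem_image.1 hx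
      rw [← h, mem_filter] at ha
      exact ha.2
    · rw [card_image_of_injective _ (mul_left_injective d)]
  · intro h
    apply filter_true_of_mem
    intro a ha
    rw [← h]
    exact mem_image_of_mem _ ha

/-- `dB = B` iff `{b ∈ B : db ∈ B} = B`. [folklore] -/
@[to_additive]
private theorem filter_mulLeft_eq_self_iff (B : Finset G) (d : G) :
    B.filter (fun b => d * b ∈ B) = B ↔ B.image (d * ·) = B := by
  constructor
  · intro h
    apply eq_of_subset_of_card_le
    · intro x hx
      obtain ⟨b, hb, rfl⟩ := mem_image.1 hx
      rw [← h, mem_filter] at hb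
      exact hb.2
    · rw [card_image_of_injective _ (mul_right_injective d)]
  · intro h
    apply filter_true_of_mem
    intro b hb
    rw [← h]
    exact mem_image_of_mem _ hb

/-- **Olson 1984, Theorem 3 (Kemperman's transformation).**  "Let `A` and `B` be two finite sets
in a group `G`.  Assume that there is an element `d ∈ −A + A ∩ B − B` such that either
`A + d ≠ A` or `d + B ≠ B`.  Then one can construct two sets `A₁` and `B₁` in `G` satisfying
(i) `A₁ + B₁ ⊆ A + B`, and (ii) either `|A₁| + |B₁| = |A| + |B|` and `|A₁| > |A|` or
`|A₁| + |B₁| > |A| + |B|`."  Multiplicatively: `d ∈ A⁻¹A ∩ BB⁻¹`, `Ad ≠ A ∨ dB ≠ B`; the new sets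
are `(A ∪ Ad, B ∩ d⁻¹B)` if `p ≥ q` and `(A ∩ Ad⁻¹, B ∪ dB)` if `p < q` (both non-empty), as
printed. [cite: Olson1984, Thm 3] -/
@[to_additive exists_kemperman_addTransform /-- Additive-notation version (Olson writes his groups additively; statement and sources as for
the multiplicative declaration, Olson 1984). -/]
theorem exists_kemperman_transform {A B : Finset G} {d : G} (hdA : d ∈ A⁻¹ * A)
    (hdB : d ∈ B * B⁻¹) (hne : A.image (· * d) ≠ A ∨ B.image (d * ·) ≠ B) :
    ∃ A₁ B₁ : Finset G, A₁.Nonempty ∧ B₁.Nonempty ∧ A₁ * B₁ ⊆ A * B ∧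
      ((#A₁ + #B₁ = #A + #B ∧ #A < #A₁) ∨ #A + #B < #A₁ + #B₁) := by
  -- the two candidate pairs
  set A₁ := A ∪ A.image (· * d) with hA₁
  set B₁ := B.filter (fun b => d * b ∈ B) with hB₁
  set A₂ := A.filter (fun a => a * d ∈ A) with hA₂
  set B₂ := B ∪ B.image (d * ·) with hB₂
  have hcA := card_union_mulRight_add_card_filter A d
  have hcB := card_union_mulLeft_add_card_filter B d
  rw [← hA₁, ← hA₂] at hcA
  rw [← hB₂, ← hB₁] at hcB
  -- non-emptiness of the shrunken sets: `d = a₁⁻¹ a₂ = b₁ b₂⁻¹`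
  have hA₂ne : A₂.Nonempty := by
    obtain ⟨x, hx, a₂, ha₂, hd⟩ := mem_mul.1 hdA
    obtain ⟨a₁, ha₁, rfl⟩ := mem_inv.1 hx
    refine ⟨a₁, mem_filter.2 ⟨ha₁, ?_⟩⟩
    rw [← hd, ← mul_assoc, mul_inv_cancel, one_mul]
    exact ha₂
  have hB₁ne : B₁.Nonempty := by
    obtain ⟨b₁, hb₁, y, hy, hd⟩ := mem_mul.1 hdB
    obtain ⟨b₂, hb₂, rfl⟩ := mem_inv.1 hy
    refine ⟨b₂, mem_filter.2 ⟨hb₂, ?_⟩⟩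
    rw [← hd, mul_assoc, inv_mul_cancel, mul_one]
    exact hb₁
  have hAne : A.Nonempty := by
    obtain ⟨x, hx, a₂, ha₂, _⟩ := mem_mul.1 hdA
    exact ⟨a₂, ha₂⟩
  have hBne : B.Nonempty := by
    obtain ⟨b₁, hb₁, _, _, _⟩ := mem_mul.1 hdB
    exact ⟨b₁, hb₁⟩
  -- `p > 0` or `q > 0`
  have hA₂le : #A₂ ≤ #A := card_filter_le _ _
  have hB₁le : #B₁ ≤ #B := card_filter_le _ _
  have hpq : #A₂ < #A ∨ #B₁ < #B := by
    rcases hne with hne | hne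
    · left
      refine lt_of_le_of_ne hA₂le fun heq => hne ?_
      exact (filter_mulRight_eq_self_iff A d).1 (eq_of_subset_of_card_le (filter_subset _ _) heq.ge)
    · right
      refine lt_of_le_of_ne hB₁le fun heq => hne ?_
      exact (filter_mulLeft_eq_self_iff B d).1 (eq_of_subset_of_card_le (filter_subset _ _) heq.ge)
  -- compare `p = #A - #A₂` with `q = #B - #B₁`
  by_cases hcase : #B - #B₁ ≤ #A - #A₂
  · refine ⟨A₁, B₁, hAne.mono subset_union_left, hB₁ne, union_mulRight_mul_filter_subset A B d, ?_⟩
    omega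
  · refine ⟨A₂, B₂, hA₂ne, hBne.mono subset_union_left, filter_mul_union_mulLeft_subset A B d,
      Or.inr ?_⟩
    omega

/-- **Iterating Kemperman's transformation** (Olson 1984, §3, first paragraph / §2 proof of Thm 4):
from finite non-empty `A, B` one reaches a pair `(E, F)` of non-empty sets with `E·F ⊆ A·B`,
`|E| + |F| ≥ |A| + |B|`, to which the transformation no longer applies — every
`d ∈ E⁻¹E ∩ FF⁻¹` satisfies `Ed = E` and `dF = F` ("the sequence must terminate since the ordered
pair `(|A_k| + |B_k|, |A_k|)` increases lexicographically … bounded above by `|C|`").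
[cite: Olson1984, Thm 2 (proof, §3)] -/
@[to_additive exists_addTerminal_pair /-- Additive-notation version (Olson writes his groups additively; statement and sources as for
the multiplicative declaration, Olson 1984). -/]
theorem exists_terminal_pair (A B : Finset G) (hA : A.Nonempty) (hB : B.Nonempty) :
    ∃ E F : Finset G, E.Nonempty ∧ F.Nonempty ∧ E * F ⊆ A * B ∧ #A + #B ≤ #E + #F ∧
      (∀ d ∈ E⁻¹ * E, d ∈ F * F⁻¹ → E.image (· * d) = E ∧ F.image (d * ·) = F) := by
  -- potential: `k = 2M + 1 - (#E + #F)`, then `j = M - #E`, with `M = #(A B)`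
  set M := #(A * B) with hM
  have key : ∀ k j : ℕ, ∀ E F : Finset G, E.Nonempty → F.Nonempty → E * F ⊆ A * B →
      2 * M + 1 - (#E + #F) = k → M - #E = j →
      ∃ E' F' : Finset G, E'.Nonempty ∧ F'.Nonempty ∧ E' * F' ⊆ A * B ∧ #E + #F ≤ #E' + #F' ∧
        (∀ d ∈ E'⁻¹ * E', d ∈ F' * F'⁻¹ → E'.image (· * d) = E' ∧ F'.image (d * ·) = F') := by
    intro k
    induction k using Nat.strong_induction_on with
    | _ k ihk =>
    intro j
    induction j using Nat.strong_induction_on with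
    | _ j ihj =>
    intro E F hE hF hEF hk hj
    by_cases hterm : ∀ d ∈ E⁻¹ * E, d ∈ F * F⁻¹ → E.image (· * d) = E ∧ F.image (d * ·) = F
    · exact ⟨E, F, hE, hF, hEF, le_rfl, hterm⟩
    · simp only [not_forall, exists_prop] at hterm
      obtain ⟨d, hdE, hdF, hne⟩ := hterm
      have hne' : E.image (· * d) ≠ E ∨ F.image (d * ·) ≠ F := by
        by_contra h
        push Not at h
        exact hne h
      obtain ⟨E₁, F₁, hE₁, hF₁, hsub, hcard⟩ := exists_kemperman_transform hdE hdF hne'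
      have hsub' : E₁ * F₁ ⊆ A * B := hsub.trans hEF
      -- sizes stay below `M`
      have hE₁M : #E₁ ≤ M :=
        (card_le_card_mul_right hF₁).trans (card_le_card hsub')
      have hF₁M : #F₁ ≤ M :=
        (card_le_card_mul_left hE₁).trans (card_le_card hsub')
      have hEM : #E ≤ M := (card_le_card_mul_right hF).trans (card_le_card hEF)
      rcases hcard with ⟨hsum, hlt⟩ | hsum
      · -- same `k`, smaller `j`
        obtain ⟨E', F', hE', hF', hsub'', hcard', hterm'⟩ :=
          ihj (M - #E₁) (by omega) E₁ F₁ hE₁ hF₁ hsub' (by omega) rfl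
        exact ⟨E', F', hE', hF', hsub'', by omega, hterm'⟩
      · -- smaller `k`
        obtain ⟨E', F', hE', hF', hsub'', hcard', hterm'⟩ :=
          ihk (2 * M + 1 - (#E₁ + #F₁)) (by omega) (M - #E₁) E₁ F₁ hE₁ hF₁ hsub' rfl rfl
        exact ⟨E', F', hE', hF', hsub'', by omega, hterm'⟩
  exact key _ _ A B hA hB subset_rfl rfl rfl

/-- `E⁻¹E` is closed under inversion. [folklore] -/
@[to_additive]
private theorem inv_mem_inv_mul_self {E : Finset G} {x : G} (hx : x ∈ E⁻¹ * E) : x⁻¹ ∈ E⁻¹ * E := by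
  obtain ⟨u, hu, v, hv, rfl⟩ := mem_mul.1 hx
  obtain ⟨e, he, rfl⟩ := mem_inv.1 hu
  rw [mul_inv_rev, inv_inv]
  exact mem_mul.2 ⟨v⁻¹, inv_mem_inv hv, e, he, rfl⟩

/-- `FF⁻¹` is closed under inversion. [folklore] -/
@[to_additive]
private theorem inv_mem_mul_inv_self {F : Finset G} {x : G} (hx : x ∈ F * F⁻¹) : x⁻¹ ∈ F * F⁻¹ := by
  obtain ⟨u, hu, v, hv, rfl⟩ := mem_mul.1 hx
  obtain ⟨f, hf, rfl⟩ := mem_inv.1 hv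
  rw [mul_inv_rev, inv_inv]
  exact mem_mul.2 ⟨f, hf, u⁻¹, inv_mem_inv hu, rfl⟩

/-- "If `F − F ⊄ −E + E`, then `x − y ∉ −E + E` for some pair `x, y ∈ F`, hence
`E + x ∩ E + y = ∅`" (Olson, proof of Thm 2): right translates `Ex`, `Ey` are disjoint when
`xy⁻¹ ∉ E⁻¹E`. [cite: Olson1984, Thm 2 (proof)] -/
@[to_additive]
private theorem disjoint_mulRight_of_not_mem {E : Finset G} {x y : G} (h : x * y⁻¹ ∉ E⁻¹ * E) :
    Disjoint (E.image (· * x)) (E.image (· * y)) := by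
  rw [disjoint_left]
  rintro z hz hz'
  obtain ⟨e₁, he₁, rfl⟩ := mem_image.1 hz
  obtain ⟨e₂, he₂, he⟩ := mem_image.1 hz'
  apply h
  -- `e₂ y = e₁ x` ⇒ `x y⁻¹ = e₁⁻¹ e₂`
  have : x * y⁻¹ = e₁⁻¹ * e₂ := by
    rw [eq_inv_mul_iff_mul_eq, ← mul_assoc, ← he, mul_assoc, mul_inv_cancel, mul_one]
  rw [this]
  exact mem_mul.2 ⟨e₁⁻¹, inv_mem_inv he₁, e₂, he₂, rfl⟩

/-- The mirror image: left translates `xF`, `yF` are disjoint when `x⁻¹y ∉ FF⁻¹`.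
[cite: Olson1984, Thm 2 (proof)] -/
@[to_additive]
private theorem disjoint_mulLeft_of_not_mem {F : Finset G} {x y : G} (h : x⁻¹ * y ∉ F * F⁻¹) :
    Disjoint (F.image (x * ·)) (F.image (y * ·)) := by
  rw [disjoint_left]
  rintro z hz hz'
  obtain ⟨f₁, hf₁, rfl⟩ := mem_image.1 hz
  obtain ⟨f₂, hf₂, he⟩ := mem_image.1 hz'
  apply h
  have : x⁻¹ * y = f₁ * f₂⁻¹ := by
    rw [eq_mul_inv_iff_mul_eq, mul_assoc, he, ← mul_assoc, inv_mul_cancel, one_mul]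
  rw [this]
  exact mem_mul.2 ⟨f₁, hf₁, f₂⁻¹, inv_mem_inv hf₂, rfl⟩

/-- **Olson 1984, Theorem 2** (finite-set form).  "If `C = A + B`, where `A` and `B` are finite
subsets in a group `G`, then there is a subset `S` of `C` and a subgroup `H` of `G` such that
`|S| ≥ |A| + |B| − |H|`, and either `H + S = S` or `S + H = S`."  Here for non-empty `A, B`, with
`S ≠ ∅` and `H` a finite subset containing `1` and closed under `*` and `⁻¹` (hence a subgroup; see
`exists_subset_subgroup` for the bundled form), `#A + #B ≤ #S + #H`, `H * S = S ∨ S * H = S`.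
Proof as printed (§3) from a terminal pair `(E, F)`, `S = E·F`, with `H = {1}`, `F⁻¹F` or `EE⁻¹`
(see the module docstring for the one deviation). [cite: Olson1984, Thm 2] -/
@[to_additive /-- Additive-notation version (Olson writes his groups additively; statement and sources as for
the multiplicative declaration, Olson 1984). -/]
theorem exists_subset_finsetSubgroup (A B : Finset G) (hA : A.Nonempty) (hB : B.Nonempty) :
    ∃ S H : Finset G, S ⊆ A * B ∧ S.Nonempty ∧ (1 : G) ∈ H ∧ (∀ x ∈ H, ∀ y ∈ H, x * y ∈ H) ∧
      (∀ x ∈ H, x⁻¹ ∈ H) ∧ #A + #B ≤ #S + #H ∧ (H * S = S ∨ S * H = S) := by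
  obtain ⟨E, F, hE, hF, hEF, hcard, hterm⟩ := exists_terminal_pair A B hA hB
  obtain ⟨e₀, he₀⟩ := hE
  obtain ⟨f₀, hf₀⟩ := hF
  have hSE : #E ≤ #(E * F) := card_le_card_mul_right ⟨f₀, hf₀⟩
  have hSF : #F ≤ #(E * F) := card_le_card_mul_left ⟨e₀, he₀⟩
  -- the trivial subgroup suffices as soon as `|E F| ≥ |E| + |F|`
  have htriv : #E + #F ≤ #(E * F) → ∃ S H : Finset G, S ⊆ A * B ∧ S.Nonempty ∧ (1 : G) ∈ H ∧
      (∀ x ∈ H, ∀ y ∈ H, x * y ∈ H) ∧ (∀ x ∈ H, x⁻¹ ∈ H) ∧ #A + #B ≤ #S + #H ∧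
      (H * S = S ∨ S * H = S) := by
    intro hbig
    refine ⟨E * F, {1}, hEF, ⟨e₀ * f₀, mul_mem_mul he₀ hf₀⟩, mem_singleton_self _,
      by simp, by simp, ?_, Or.inl (by rw [Finset.singleton_one, one_mul])⟩
    rw [card_singleton]
    omega
  by_cases hle : #F ≤ #E
  · by_cases hsub : F * F⁻¹ ⊆ E⁻¹ * E
    · -- `H = F⁻¹ F`, fixing `S = E F` on the right
      have hfix : ∀ d ∈ F * F⁻¹, ∀ f ∈ F, d * f ∈ F := by
        intro d hd f hf
        have := (hterm d (hsub hd) hd).2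
        rw [← this]
        exact mem_image_of_mem _ hf
      refine ⟨E * F, F⁻¹ * F, hEF, ⟨e₀ * f₀, mul_mem_mul he₀ hf₀⟩, ?_, ?_, ?_, ?_, Or.inr ?_⟩
      · exact mem_mul.2 ⟨f₀⁻¹, inv_mem_inv hf₀, f₀, hf₀, inv_mul_cancel f₀⟩
      · intro x hx y hy
        obtain ⟨u₁, hu₁, f₂, hf₂, rfl⟩ := mem_mul.1 hx
        obtain ⟨u₃, hu₃, f₄, hf₄, rfl⟩ := mem_mul.1 hy
        obtain ⟨f₃, hf₃, rfl⟩ := mem_inv.1 hu₃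
        -- `(u₁ f₂)(f₃⁻¹ f₄) = u₁ ((f₂ f₃⁻¹) f₄)` with `f₂ f₃⁻¹ ∈ F F⁻¹`
        have hmem : f₂ * f₃⁻¹ * f₄ ∈ F :=
          hfix _ (mem_mul.2 ⟨f₂, hf₂, f₃⁻¹, inv_mem_inv hf₃, rfl⟩) f₄ hf₄
        have : u₁ * f₂ * (f₃⁻¹ * f₄) = u₁ * (f₂ * f₃⁻¹ * f₄) := by simp only [mul_assoc]
        rw [this]
        exact mem_mul.2 ⟨u₁, hu₁, _, hmem, rfl⟩
      · intro x hx
        exact inv_mem_inv_mul_self hx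
      · have : #F ≤ #(F⁻¹ * F) := by
          calc #F = #(F.image (f₀⁻¹ * ·)) :=
                (card_image_of_injective _ (mul_right_injective _)).symm
            _ ≤ #(F⁻¹ * F) := card_le_card fun z hz => by
                obtain ⟨f, hf, rfl⟩ := mem_image.1 hz
                exact mem_mul.2 ⟨f₀⁻¹, inv_mem_inv hf₀, f, hf, rfl⟩
        omega
      · apply Subset.antisymm
        · intro z hz
          obtain ⟨s, hs, h, hh, rfl⟩ := mem_mul.1 hz
          obtain ⟨e, he, f, hf, rfl⟩ := mem_mul.1 hs
          obtain ⟨u, hu, f₂, hf₂, rfl⟩ := mem_mul.1 hh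
          obtain ⟨f₁, hf₁, rfl⟩ := mem_inv.1 hu
          have hmem : f * f₁⁻¹ * f₂ ∈ F :=
            hfix _ (mem_mul.2 ⟨f, hf, f₁⁻¹, inv_mem_inv hf₁, rfl⟩) f₂ hf₂
          have : e * f * (f₁⁻¹ * f₂) = e * (f * f₁⁻¹ * f₂) := by simp only [mul_assoc]
          rw [this]
          exact mul_mem_mul he hmem
        · intro z hz
          rw [← mul_one z]
          exact mul_mem_mul hz (mem_mul.2 ⟨f₀⁻¹, inv_mem_inv hf₀, f₀, hf₀, inv_mul_cancel f₀⟩)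
    · -- two disjoint right translates of `E` inside `E F`
      obtain ⟨z, hzF, hzE⟩ := not_subset.1 hsub
      obtain ⟨x, hx, v, hv, rfl⟩ := mem_mul.1 hzF
      obtain ⟨y, hy, rfl⟩ := mem_inv.1 hv
      apply htriv
      have hdisj := disjoint_mulRight_of_not_mem hzE
      have h2 : #(E.image (· * x) ∪ E.image (· * y)) ≤ #(E * F) :=
        card_le_card (union_subset
          (fun z hz => by obtain ⟨e, he, rfl⟩ := mem_image.1 hz; exact mul_mem_mul he hx)
          (fun z hz => by obtain ⟨e, he, rfl⟩ := mem_image.1 hz; exact mul_mem_mul he hy))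
      rw [card_union_of_disjoint hdisj, card_image_of_injective _ (mul_left_injective _),
        card_image_of_injective _ (mul_left_injective _)] at h2
      omega
  · push Not at hle
    by_cases hsub : E⁻¹ * E ⊆ F * F⁻¹
    · -- `H = E E⁻¹`, fixing `S` on the left
      have hfix : ∀ d ∈ E⁻¹ * E, ∀ e ∈ E, e * d ∈ E := by
        intro d hd e he
        have := (hterm d hd (hsub hd)).1
        rw [← this]
        exact mem_image_of_mem _ he
      refine ⟨E * F, E * E⁻¹, hEF, ⟨e₀ * f₀, mul_mem_mul he₀ hf₀⟩, ?_, ?_, ?_, ?_, Or.inl ?_⟩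
      · exact mem_mul.2 ⟨e₀, he₀, e₀⁻¹, inv_mem_inv he₀, mul_inv_cancel e₀⟩
      · intro x hx y hy
        obtain ⟨e₁, he₁, u₂, hu₂, rfl⟩ := mem_mul.1 hx
        obtain ⟨e₃, he₃, u₄, hu₄, rfl⟩ := mem_mul.1 hy
        obtain ⟨e₂, he₂, rfl⟩ := mem_inv.1 hu₂
        have hmem : e₁ * (e₂⁻¹ * e₃) ∈ E :=
          hfix _ (mem_mul.2 ⟨e₂⁻¹, inv_mem_inv he₂, e₃, he₃, rfl⟩) e₁ he₁
        have : e₁ * e₂⁻¹ * (e₃ * u₄) = e₁ * (e₂⁻¹ * e₃) * u₄ := by simp only [mul_assoc]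
        rw [this]
        exact mem_mul.2 ⟨_, hmem, u₄, hu₄, rfl⟩
      · intro x hx
        exact inv_mem_mul_inv_self hx
      · have : #E ≤ #(E * E⁻¹) := by
          calc #E = #(E.image (· * e₀⁻¹)) :=
                (card_image_of_injective _ (mul_left_injective _)).symm
            _ ≤ #(E * E⁻¹) := card_le_card fun z hz => by
                obtain ⟨e, he, rfl⟩ := mem_image.1 hz
                exact mem_mul.2 ⟨e, he, e₀⁻¹, inv_mem_inv he₀, rfl⟩
        omega
      · apply Subset.antisymm
        · intro z hz
          obtain ⟨h, hh, s, hs, rfl⟩ := mem_mul.1 hz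
          obtain ⟨e, he, f, hf, rfl⟩ := mem_mul.1 hs
          obtain ⟨e₁, he₁, u, hu, rfl⟩ := mem_mul.1 hh
          obtain ⟨e₂, he₂, rfl⟩ := mem_inv.1 hu
          have hmem : e₁ * (e₂⁻¹ * e) ∈ E :=
            hfix _ (mem_mul.2 ⟨e₂⁻¹, inv_mem_inv he₂, e, he, rfl⟩) e₁ he₁
          have : e₁ * e₂⁻¹ * (e * f) = e₁ * (e₂⁻¹ * e) * f := by simp only [mul_assoc]
          rw [this]
          exact mul_mem_mul hmem hf
        · intro z hz
          rw [← one_mul z]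
          exact mul_mem_mul (mem_mul.2 ⟨e₀, he₀, e₀⁻¹, inv_mem_inv he₀, mul_inv_cancel e₀⟩) hz
    · obtain ⟨z, hzE, hzF⟩ := not_subset.1 hsub
      obtain ⟨u, hu, y, hy, rfl⟩ := mem_mul.1 hzE
      obtain ⟨x, hx, rfl⟩ := mem_inv.1 hu
      apply htriv
      have hdisj := disjoint_mulLeft_of_not_mem hzF
      have h2 : #(F.image (x * ·) ∪ F.image (y * ·)) ≤ #(E * F) :=
        card_le_card (union_subset
          (fun z hz => by obtain ⟨f, hf, rfl⟩ := mem_image.1 hz; exact mul_mem_mul hx hf)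
          (fun z hz => by obtain ⟨f, hf, rfl⟩ := mem_image.1 hz; exact mul_mem_mul hy hf))
      rw [card_union_of_disjoint hdisj, card_image_of_injective _ (mul_right_injective _),
        card_image_of_injective _ (mul_right_injective _)] at h2
      omega

/-- "`S + B = S`; it follows that `S + b = S` since `S` is a finite set" (Olson §4, Case 1).
[cite: Olson1984, Thm 1 (proof, Case 1)] -/
@[to_additive]
private theorem image_mulRight_eq_of_mul_eq {S B : Finset G} (h : S * B = S) {b : G} (hb : b ∈ B) :
    S.image (· * b) = S := by
  apply eq_of_subset_of_card_le
  · intro z hz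
    obtain ⟨s, hs, rfl⟩ := mem_image.1 hz
    rw [← h]
    exact mul_mem_mul hs hb
  · rw [card_image_of_injective _ (mul_left_injective b)]

/-- Inequality (6) of Olson's proof of Theorem 1, case `H + S = S`: "both sets `S` and `S + b₀`
are unions of complete left cosets of `H`", so `|(S + b₀) ∖ S| ≥ |H|` as soon as some
`s₀ + b₀ ∉ S`. [cite: Olson1984, Thm 1 (proof, (6))] -/
@[to_additive card_le_card_image_sdiff_of_left_addInvariant]
private theorem card_le_card_image_sdiff_of_left_invariant {S H : Finset G} {b₀ s₀ : G}
    (hHS : H * S = S) (hinv : ∀ x ∈ H, x⁻¹ ∈ H) (hs₀ : s₀ ∈ S) (hsb : s₀ * b₀ ∉ S) :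
    #H ≤ #(S.image (· * b₀) \ S) := by
  calc #H = #(H.image (· * (s₀ * b₀))) := (card_image_of_injective _ (mul_left_injective _)).symm
    _ ≤ #(S.image (· * b₀) \ S) := card_le_card fun z hz => by
        obtain ⟨h, hh, rfl⟩ := mem_image.1 hz
        rw [mem_sdiff]
        constructor
        · rw [← mul_assoc]
          apply mem_image_of_mem
          rw [← hHS]
          exact mul_mem_mul hh hs₀
        · intro hmem
          apply hsb
          have : s₀ * b₀ = h⁻¹ * (h * (s₀ * b₀)) := by rw [← mul_assoc, inv_mul_cancel, one_mul]
          rw [this, ← hHS]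
          exact mul_mem_mul (hinv h hh) hmem

/-- Inequality (6) of Olson's proof of Theorem 1, case `S + H = S`: with `T = H ∪ {b₀}`, the
element `s₀ + b₀ ∉ S` "appears exactly once in the sum `S + T`.  Hence by Theorem 4
`|S ∪ S + b₀| = |S + T| ≥ |S| + |T| − 1 = |S| + |H|`" — through the tree's
`kemperman_card_add_card_le_of_unique_mul`. [cite: Olson1984, Thm 1 (proof, (6))] -/
@[to_additive card_le_card_image_sdiff_of_right_addInvariant]
private theorem card_le_card_image_sdiff_of_right_invariant {S H : Finset G} {b₀ s₀ : G}
    (hSH : S * H = S) (hs₀ : s₀ ∈ S) (hsb : s₀ * b₀ ∉ S) :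
    #H ≤ #(S.image (· * b₀) \ S) := by
  have hb₀ : b₀ ∉ H := fun hb => hsb (by rw [← hSH]; exact mul_mem_mul hs₀ hb)
  -- `T = H ∪ {b₀}`; `s₀ b₀` is uniquely represented in `S · T`
  have huniq : ∀ s ∈ S, ∀ t ∈ insert b₀ H, s * t = s₀ * b₀ → s = s₀ ∧ t = b₀ := by
    intro s hs t ht he
    rw [mem_insert] at ht
    rcases ht with rfl | ht
    · exact ⟨mul_right_cancel he, rfl⟩
    · exfalso
      apply hsb
      rw [← he, ← hSH]
      exact mul_mem_mul hs ht
  have hK := kemperman_card_add_card_le_of_unique_mul hs₀ (mem_insert_self b₀ H) huniq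
  have hTcard : #(insert b₀ H) = #H + 1 := by rw [card_insert_of_notMem hb₀]
  -- `S T = S b₀ ∪ S`
  have hST : S * insert b₀ H = S.image (· * b₀) ∪ S := by
    ext z
    rw [mem_union, mem_image]
    constructor
    · intro hz
      obtain ⟨s, hs, t, ht, rfl⟩ := mem_mul.1 hz
      rw [mem_insert] at ht
      rcases ht with rfl | ht
      · exact Or.inl ⟨s, hs, rfl⟩
      · right
        rw [← hSH]
        exact mul_mem_mul hs ht
    · rintro (⟨s, hs, rfl⟩ | hz)
      · exact mul_mem_mul hs (mem_insert_self _ _)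
      · rw [← hSH] at hz
        obtain ⟨s, hs, h, hh, rfl⟩ := mem_mul.1 hz
        exact mul_mem_mul hs (mem_insert_of_mem hh)
  rw [hST, hTcard, ← card_sdiff_add_card] at hK
  omega

/-- Theorem 1 by induction on `|C|` (the printed induction, §4). [cite: Olson1984, Thm 1] -/
@[to_additive]
private theorem mul_right_eq_or_card_le_aux : ∀ (n : ℕ) (A B : Finset G), (1 : G) ∈ B →
    #(A * B) = n → A * B * B = A * B ∨ 2 * #A + #B ≤ 2 * #(A * B) := by
  intro n
  induction n using Nat.strong_induction_on with
  | _ n ih =>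
  intro A B h1B hn
  rcases A.eq_empty_or_nonempty with rfl | hA
  · left; simp
  have hB : B.Nonempty := ⟨1, h1B⟩
  -- `A ⊆ C`
  have hAC : A ⊆ A * B := fun a ha => by
    rw [← mul_one a]; exact mul_mem_mul ha h1B
  obtain ⟨S, H, hSC, hSne, hH1, hHmul, hHinv, hcard5, hfix⟩ :=
    exists_subset_finsetSubgroup A B hA hB
  by_cases hSB : S * B = S
  · -- Case 1: `S B = S`; split `A = A₁ ⊔ A₂` along `S`
    set A₁ := A.filter (· ∈ S) with hA₁
    set A₂ := A.filter (· ∉ S) with hA₂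
    have hA₁S : A₁ * B = S := by
      apply Subset.antisymm
      · intro z hz
        obtain ⟨a, ha, b, hb, rfl⟩ := mem_mul.1 hz
        rw [← hSB]
        exact mul_mem_mul (mem_filter.1 ha).2 hb
      · intro s hs
        obtain ⟨a, ha, b, hb, rfl⟩ := mem_mul.1 (hSC hs)
        -- `a b ∈ S = S b` forces `a ∈ S`
        have haS : a ∈ S := by
          have : a * b ∈ S.image (· * b) := by rwa [image_mulRight_eq_of_mul_eq hSB hb]
          obtain ⟨s', hs', he⟩ := mem_image.1 this
          rw [← mul_right_cancel he]
          exact hs'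
        exact mul_mem_mul (mem_filter.2 ⟨ha, haS⟩) hb
    have hA₂S : Disjoint (A₂ * B) S := by
      rw [disjoint_left]
      intro z hz hzS
      obtain ⟨a, ha, b, hb, rfl⟩ := mem_mul.1 hz
      have : a * b ∈ S.image (· * b) := by rwa [image_mulRight_eq_of_mul_eq hSB hb]
      obtain ⟨s', hs', he⟩ := mem_image.1 this
      exact (mem_filter.1 ha).2 (by rw [← mul_right_cancel he]; exact hs')
    have hAsplit : A = A₁ ∪ A₂ := by
      rw [hA₁, hA₂]; exact (filter_union_filter_not_eq _ _).symm
    have hCsplit : A * B = S ∪ A₂ * B := by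
      rw [hAsplit, union_mul, hA₁S]
    have hCcard : #(A * B) = #S + #(A₂ * B) := by
      rw [hCsplit, card_union_of_disjoint hA₂S.symm]
    have hAcard : #A = #A₁ + #A₂ := by
      rw [hA₁, hA₂]; exact (card_filter_add_card_filter_not _).symm
    by_cases hCB : A * B * B = A * B
    · exact Or.inl hCB
    · right
      -- `A₂ B B ≠ A₂ B` (else `C B = C`)
      have hA₂BB : A₂ * B * B ≠ A₂ * B := by
        intro he
        apply hCB
        rw [hCsplit, union_mul, hSB, he]
      have hlt : #(A₂ * B) < n := by
        rw [← hn, hCcard]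
        have := hSne.card_pos
        omega
      have ih' := ih _ hlt A₂ B h1B rfl
      rcases ih' with h | h
      · exact absurd h hA₂BB
      · have h1 : #A₁ ≤ #S := by
          rw [← hA₁S]; exact card_le_card_mul_right hB
        omega
  · -- Case 2: some `b₀ ∈ B` moves `S`
    have : ∃ b₀ ∈ B, ∃ s₀ ∈ S, s₀ * b₀ ∉ S := by
      by_contra hcon
      push Not at hcon
      apply hSB
      apply Subset.antisymm
      · intro z hz
        obtain ⟨s, hs, b, hb, rfl⟩ := mem_mul.1 hz
        exact hcon b hb s hs
      · intro s hs
        rw [← mul_one s]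
        exact mul_mem_mul hs h1B
    obtain ⟨b₀, hb₀, s₀, hs₀, hsb⟩ := this
    -- (6): at least `|H|` elements of `S` leave `S` under `· * b₀`
    have h6 : #H ≤ #(S.image (· * b₀) \ S) := by
      rcases hfix with hHS | hSH
      · exact card_le_card_image_sdiff_of_left_invariant hHS hHinv hs₀ hsb
      · exact card_le_card_image_sdiff_of_right_invariant hSH hs₀ hsb
    -- the movers, split by whether they land in `C`
    set Mv := S.filter (fun s => s * b₀ ∉ S) with hMv
    have hMvcard : #Mv = #(S.image (· * b₀) \ S) := by
      rw [hMv]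
      refine card_bij (fun s _ => s * b₀) ?_ ?_ ?_
      · intro s hs
        rw [mem_filter] at hs
        exact mem_sdiff.2 ⟨mem_image_of_mem _ hs.1, hs.2⟩
      · intro s₁ _ s₂ _ he
        exact mul_right_cancel he
      · intro z hz
        rw [mem_sdiff, mem_image] at hz
        obtain ⟨⟨s, hs, rfl⟩, hzS⟩ := hz
        exact ⟨s, mem_filter.2 ⟨hs, hzS⟩, rfl⟩
    set P := Mv.filter (fun s => s * b₀ ∈ A * B) with hP
    set Q := Mv.filter (fun s => s * b₀ ∉ A * B) with hQ
    have hPQ : #P + #Q = #Mv := by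
      rw [hP, hQ]; exact card_filter_add_card_filter_not _
    set A₀ := A.filter (· ∈ S) with hA₀
    -- (7) `|C| - |S| ≥ |A| - |A₀|`
    have h7 : #A - #A₀ ≤ #(A * B) - #S := by
      have e1 : #A - #A₀ = #(A.filter (· ∉ S)) := by
        have := card_filter_add_card_filter_not (s := A) (· ∈ S)
        rw [← hA₀] at this
        omega
      have e2 : #(A * B) - #S = #((A * B) \ S) := by
        rw [card_sdiff_of_subset hSC]
      rw [e1, e2]
      refine card_le_card fun a ha => ?_
      rw [mem_filter] at ha
      exact mem_sdiff.2 ⟨hAC ha.1, ha.2⟩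
    -- (8) `|C| ≥ |S| + |P|`
    have h8 : #S + #P ≤ #(A * B) := by
      have : #P ≤ #((A * B) \ S) := by
        calc #P = #(P.image (· * b₀)) := (card_image_of_injective _ (mul_left_injective _)).symm
          _ ≤ #((A * B) \ S) := card_le_card fun z hz => by
              obtain ⟨s, hs, rfl⟩ := mem_image.1 hz
              rw [hP, mem_filter, hMv, mem_filter] at hs
              exact mem_sdiff.2 ⟨hs.2, hs.1.2⟩
      rw [card_sdiff_of_subset hSC] at this
      have := card_le_card hSC
      omega
    -- (9) `|S| ≥ |A₀| + |Q|`
    have h9 : #A₀ + #Q ≤ #S := by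
      have hdisj : Disjoint A₀ Q := by
        rw [disjoint_left]
        intro s hsA hsQ
        rw [hA₀, mem_filter] at hsA
        rw [hQ, mem_filter] at hsQ
        exact hsQ.2 (mul_mem_mul hsA.1 hb₀)
      rw [← card_union_of_disjoint hdisj]
      refine card_le_card (union_subset (fun s hs => (mem_filter.1 hs).2) fun s hs => ?_)
      rw [hQ, mem_filter, hMv, mem_filter] at hs
      exact hs.1.1
    right
    have hA₀le : #A₀ ≤ #A := card_filter_le _ _
    have hSle : #S ≤ #(A * B) := card_le_card hSC
    omega

/-- **Olson 1984, Theorem 1.**  "Let `C = A + B`, where `A` and `B` are finite subsets of a group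
`G` and `0 ∈ B`.  Then either `C + B = C` or `|C| ≥ |A| + ½|B|`."  Multiplicatively, for any
group: `1 ∈ B → A·B·B = A·B ∨ 2|A| + |B| ≤ 2|A·B|`.  (The abelian case via Kneser is
`olson_card_add` in `Chowla.lean`; Olson: "for abelian groups, Theorem 1 is easy to prove
directly".) [cite: Olson1984, Thm 1] -/
@[to_additive /-- Additive-notation version (Olson writes his groups additively; statement and sources as for
the multiplicative declaration, Olson 1984). -/]
theorem mul_right_eq_or_card_le (A B : Finset G) (h1 : (1 : G) ∈ B) :
    A * B * B = A * B ∨ 2 * #A + #B ≤ 2 * #(A * B) :=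
  mul_right_eq_or_card_le_aux _ A B h1 rfl

/-- **Olson 1984, Theorem 5.**  "Let `C = A + B`, where `A` and `B` are finite sets in a group.
Then either `C + (−B + B) = C` or `|C| ≥ |A| + ½|B|`."  (Theorem 1 applied to `A` and `B − b₀`
for a `b₀` with `C + (−b₀ + B) ≠ C`.) [cite: Olson1984, Thm 5] -/
@[to_additive /-- Additive-notation version (Olson writes his groups additively; statement and sources as for
the multiplicative declaration, Olson 1984). -/]
theorem mul_inv_mul_eq_or_card_le (A B : Finset G) :
    A * B * (B⁻¹ * B) = A * B ∨ 2 * #A + #B ≤ 2 * #(A * B) := by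
  rcases B.eq_empty_or_nonempty with rfl | hB
  · left; simp
  by_cases hall : ∀ b₀ ∈ B, A * B * {b₀⁻¹} * B = A * B
  · left
    apply Subset.antisymm
    · intro z hz
      obtain ⟨c, hc, w, hw, rfl⟩ := mem_mul.1 hz
      obtain ⟨u, hu, b, hb, rfl⟩ := mem_mul.1 hw
      obtain ⟨b₀, hb₀, rfl⟩ := mem_inv.1 hu
      rw [← hall b₀ hb₀, ← mul_assoc]
      exact mul_mem_mul (mul_mem_mul hc (mem_singleton_self _)) hb
    · intro c hc
      obtain ⟨b, hb⟩ := hB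
      exact mem_mul.2 ⟨c, hc, b⁻¹ * b, mul_mem_mul (inv_mem_inv hb) hb,
        by rw [inv_mul_cancel, mul_one]⟩
  · right
    push Not at hall
    obtain ⟨b₀, hb₀, hne⟩ := hall
    -- normalise: `B' = B b₀⁻¹ ∋ 1`, `A B' = (A B) b₀⁻¹`
    have h1 : (1 : G) ∈ B * {b₀⁻¹} := by
      rw [← mul_inv_cancel b₀]; exact mul_mem_mul hb₀ (mem_singleton_self _)
    have hAB' : A * (B * {b₀⁻¹}) = A * B * {b₀⁻¹} := (mul_assoc _ _ _).symm
    rcases mul_right_eq_or_card_le A (B * {b₀⁻¹}) h1 with h | h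
    · exfalso
      apply hne
      rw [hAB'] at h
      -- multiply `(A B b₀⁻¹)(B b₀⁻¹) = A B b₀⁻¹` on the right by `b₀`
      have := congrArg (· * ({b₀} : Finset G)) h
      simp only [mul_assoc, singleton_mul_singleton, inv_mul_cancel, Finset.singleton_one,
        mul_one] at this
      simpa [mul_assoc] using this
    · rw [hAB', card_mul_singleton, card_mul_singleton] at h
      exact h

/-- **Olson 1984, Corollary.**  "If `A` is a finite set in a group, then either
`|A − A| ≥ (3/2)|A|` or `A − A` is a subgroup" — Theorem 5 with `B = −A`: either
`(A A⁻¹)(A A⁻¹) = A A⁻¹` (so the finite set `A A⁻¹ ∋ 1` is closed, i.e. a subgroup: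
`exists_subgroup_coe_eq_mul_inv`) or `3|A| ≤ 2|A A⁻¹|`. [cite: Olson1984, Cor] -/
@[to_additive /-- Additive-notation version (Olson writes his groups additively; statement and sources as for
the multiplicative declaration, Olson 1984). -/]
theorem mul_inv_eq_or_card_le (A : Finset G) :
    A * A⁻¹ * (A * A⁻¹) = A * A⁻¹ ∨ 3 * #A ≤ 2 * #(A * A⁻¹) := by
  rcases mul_inv_mul_eq_or_card_le A A⁻¹ with h | h
  · left; rwa [inv_inv] at h
  · right; rw [card_inv] at h; omega

/-- The first alternative of the Corollary says that `A A⁻¹` IS (the carrier of) a subgroup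
(`A ≠ ∅`: it contains `1`, is closed under `*` by hypothesis and under `⁻¹` by its shape).
[cite: Olson1984, Cor] -/
@[to_additive /-- Additive-notation version (Olson writes his groups additively; statement and sources as for
the multiplicative declaration, Olson 1984). -/]
theorem exists_subgroup_coe_eq_mul_inv (A : Finset G) (hA : A.Nonempty)
    (h : A * A⁻¹ * (A * A⁻¹) = A * A⁻¹) :
    ∃ H : Subgroup G, (H : Set G) = ↑(A * A⁻¹) := by
  obtain ⟨a, ha⟩ := hA
  refine ⟨{ carrier := ↑(A * A⁻¹)
            mul_mem' := fun {x y} hx hy => ?_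
            one_mem' := ?_
            inv_mem' := fun {x} hx => ?_ }, rfl⟩
  · rw [mem_coe] at hx hy ⊢
    rw [← h]
    exact mul_mem_mul hx hy
  · rw [mem_coe, ← mul_inv_cancel a]
    exact mul_mem_mul ha (inv_mem_inv ha)
  · rw [mem_coe] at hx ⊢
    exact inv_mem_mul_inv_self hx

/-- **Olson 1984, Theorem 2** (bundled form): for finite non-empty `A, B` in any group there are
a non-empty `S ⊆ A·B` and a finite subgroup `H ≤ G` with `|A| + |B| ≤ |S| + |H|` and `H·S = S` or
`S·H = S` (every `h ∈ H` fixes `S` by left, resp. right, multiplication).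
[cite: Olson1984, Thm 2] -/
@[to_additive /-- Additive-notation version (Olson writes his groups additively; statement and sources as for
the multiplicative declaration, Olson 1984). -/]
theorem exists_subset_subgroup (A B : Finset G) (hA : A.Nonempty) (hB : B.Nonempty) :
    ∃ S : Finset G, ∃ H : Subgroup G, S ⊆ A * B ∧ S.Nonempty ∧ (H : Set G).Finite ∧
      #A + #B ≤ #S + Nat.card H ∧
      ((∀ h ∈ H, ∀ s ∈ S, h * s ∈ S) ∨ (∀ h ∈ H, ∀ s ∈ S, s * h ∈ S)) := by
  obtain ⟨S, H, hSC, hSne, hH1, hHmul, hHinv, hcard, hfix⟩ :=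
    exists_subset_finsetSubgroup A B hA hB
  let K : Subgroup G :=
    { carrier := ↑H
      mul_mem' := fun {x y} hx hy => by
        rw [mem_coe] at hx hy ⊢; exact hHmul x hx y hy
      one_mem' := by rw [mem_coe]; exact hH1
      inv_mem' := fun {x} hx => by rw [mem_coe] at hx ⊢; exact hHinv x hx }
  have hKH : (K : Set G) = ↑H := rfl
  have hKcard : Nat.card K = #H := by
    rw [← SetLike.coe_sort_coe, hKH, Nat.card_coe_set_eq, Set.ncard_coe_finset]
  refine ⟨S, K, hSC, hSne, by rw [hKH]; exact H.finite_toSet, by rw [hKcard]; exact hcard, ?_⟩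
  rcases hfix with hHS | hSH
  · left
    intro h hh s hs
    have hh' : h ∈ H := hh
    rw [← hHS]; exact mul_mem_mul hh' hs
  · right
    intro h hh s hs
    have hh' : h ∈ H := hh
    rw [← hSH]; exact mul_mem_mul hs hh'

/-- **Olson 1984, Theorem 6** (with `n = m + 1`, `m ≥ 1`).  "If `B` is a finite set in a group
and `n ≥ 2`, then either `|nB| = |(n+1)B|` or `|nB| ≥ |(n−1)B| + ½|B|`."  Multiplicatively with
Mathlib's pointwise `B ^ n`: `#(B^(m+1)) = #(B^(m+2)) ∨ 2#(B^m) + #B ≤ 2#(B^(m+1))`.  Proof as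
printed ((13)–(18)), with the set `B⁻¹B` in place of the subgroup it generates (module
docstring). [cite: Olson1984, Thm 6] -/
@[to_additive /-- Additive-notation version (Olson writes his groups additively; statement and sources as for
the multiplicative declaration, Olson 1984). -/]
theorem card_pow_eq_or_card_le (B : Finset G) (m : ℕ) (hm : 1 ≤ m) :
    #(B ^ (m + 1)) = #(B ^ (m + 2)) ∨ 2 * #(B ^ m) + #B ≤ 2 * #(B ^ (m + 1)) := by
  rcases B.eq_empty_or_nonempty with rfl | hB
  · left
    rw [empty_pow (by omega), empty_pow (by omega)]
  set C := B ^ (m + 1) with hC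
  have hCdef : B ^ m * B = C := by rw [hC, pow_succ]
  have hCdef' : B * B ^ m = C := by rw [hC, pow_succ']
  have hCne : C.Nonempty := by rw [hC]; exact hB.pow
  by_cases h14 : C * (B⁻¹ * B) = C
  swap
  · -- Theorem 5 for `A = B^m`
    rcases mul_inv_mul_eq_or_card_le (B ^ m) B with h | h
    · exact absurd (by rwa [hCdef] at h) h14
    · right; rwa [hCdef] at h
  -- right-multiplication by `B⁻¹ B` fixes `C`
  have hstab : ∀ d ∈ B⁻¹ * B, ∀ c ∈ C, c * d ∈ C := by
    intro d hd c hc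
    rw [← h14]
    exact mul_mem_mul hc hd
  by_cases hall : ∀ b₁ ∈ B, ∀ b₂ ∈ B, C.image (b₁⁻¹ * b₂ * ·) = C
  · -- all left translates `b C` coincide: `B C = b₀ C`
    left
    obtain ⟨b₀, hb₀⟩ := hB
    have : B ^ (m + 2) = C.image (b₀ * ·) := by
      rw [pow_succ', ← hC]
      apply Subset.antisymm
      · intro z hz
        obtain ⟨b, hb, c, hc, rfl⟩ := mem_mul.1 hz
        have hmem : b₀⁻¹ * b * c ∈ C := by
          rw [← hall b₀ hb₀ b hb]; exact mem_image_of_mem _ hc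
        exact mem_image.2 ⟨_, hmem, by simp only [← mul_assoc, mul_inv_cancel, one_mul]⟩
      · intro z hz
        obtain ⟨c, hc, rfl⟩ := mem_image.1 hz
        exact mul_mem_mul hb₀ hc
    rw [this, card_image_of_injective _ (mul_right_injective b₀)]
  · right
    push Not at hall
    obtain ⟨b₁, hb₁, b₂, hb₂, hne⟩ := hall
    set g := b₁⁻¹ * b₂ with hg
    -- the movers `{c ∈ C : g c ∉ C}` number at least `|B|`
    set Mv := C.filter (fun c => g * c ∉ C) with hMv
    have hMv_card : #B ≤ #Mv := by
      -- `X = gC \\ C` is non-empty and right-`B⁻¹B`-stable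
      have hX : (C.image (g * ·) \ C).Nonempty := by
        rw [nonempty_iff_ne_empty, Ne, sdiff_eq_empty_iff_subset]
        intro hsub
        exact hne (eq_of_subset_of_card_le hsub
          (by rw [card_image_of_injective _ (mul_right_injective g)]))
      obtain ⟨x₀, hx₀⟩ := hX
      rw [mem_sdiff, mem_image] at hx₀
      obtain ⟨⟨c₀, hc₀, rfl⟩, hx₀C⟩ := hx₀
      obtain ⟨b, hb⟩ := hB
      have hMvX : #Mv = #(C.image (g * ·) \ C) := by
        rw [hMv]
        refine card_bij (fun c _ => g * c) ?_ ?_ ?_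
        · intro c hc
          rw [mem_filter] at hc
          exact mem_sdiff.2 ⟨mem_image_of_mem _ hc.1, hc.2⟩
        · intro c₁ _ c₂ _ he
          exact mul_left_cancel he
        · intro z hz
          rw [mem_sdiff, mem_image] at hz
          obtain ⟨⟨c, hc, rfl⟩, hzC⟩ := hz
          exact ⟨c, mem_filter.2 ⟨hc, hzC⟩, rfl⟩
      rw [hMvX]
      calc #B = #(B.image (g * c₀ * b⁻¹ * ·)) :=
            (card_image_of_injective _ (mul_right_injective _)).symm
        _ ≤ #(C.image (g * ·) \ C) := card_le_card fun z hz => by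
            obtain ⟨b', hb', rfl⟩ := mem_image.1 hz
            have hd : b⁻¹ * b' ∈ B⁻¹ * B := mul_mem_mul (inv_mem_inv hb) hb'
            rw [mem_sdiff]
            constructor
            · rw [show g * c₀ * b⁻¹ * b' = g * (c₀ * (b⁻¹ * b')) by simp only [mul_assoc]]
              exact mem_image_of_mem _ (hstab _ hd c₀ hc₀)
            · intro hmem
              apply hx₀C
              have hd' : b'⁻¹ * b ∈ B⁻¹ * B := mul_mem_mul (inv_mem_inv hb') hb
              have := hstab _ hd' _ hmem
              rwa [show g * c₀ * b⁻¹ * b' * (b'⁻¹ * b) = g * c₀ by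
                simp only [mul_assoc, mul_inv_cancel_left, inv_mul_cancel, mul_one]] at this
    -- split the movers by membership in the right translate `B^m b₁ ⊆ C`
    set R := Mv.filter (fun c => c ∉ (B ^ m).image (· * b₁)) with hR
    set S' := Mv.filter (fun c => c ∈ (B ^ m).image (· * b₁)) with hS'
    have hRS : #S' + #R = #Mv := by rw [hS', hR]; exact card_filter_add_card_filter_not _
    have hright : (B ^ m).image (· * b₁) ⊆ C := fun z hz => by
      obtain ⟨a, ha, rfl⟩ := mem_image.1 hz
      rw [← hCdef]; exact mul_mem_mul ha hb₁
    have hleft : (B ^ m).image (b₁ * ·) ⊆ C := fun z hz => by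
      obtain ⟨a, ha, rfl⟩ := mem_image.1 hz
      rw [← hCdef']; exact mul_mem_mul hb₁ ha
    -- (17)
    have h17 : #(B ^ m) + #R ≤ #C := by
      have hdisj : Disjoint ((B ^ m).image (· * b₁)) R := by
        rw [disjoint_right]
        intro c hc
        rw [hR, mem_filter] at hc
        exact hc.2
      rw [← card_image_of_injective (B ^ m) (mul_left_injective b₁), ← card_union_of_disjoint hdisj]
      exact card_le_card (union_subset hright fun c hc => by
        rw [hR, mem_filter, hMv, mem_filter] at hc
        exact hc.1.1)
    -- (18): `c ↦ b₂ c b₁⁻¹` sends `S'` into `C \\ b₁ B^m`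
    have h18 : #(B ^ m) + #S' ≤ #C := by
      have hdisj : Disjoint ((B ^ m).image (b₁ * ·)) (S'.image (fun c => b₂ * c * b₁⁻¹)) := by
        rw [disjoint_right]
        intro z hz hz'
        obtain ⟨c, hc, rfl⟩ := mem_image.1 hz
        obtain ⟨a', ha', he⟩ := mem_image.1 hz'
        rw [hS', mem_filter, hMv, mem_filter] at hc
        apply hc.1.2
        -- `g c = b₁⁻¹ b₂ c = a' b₁ ∈ B^m b₁ ⊆ C`
        have : g * c = a' * b₁ := by
          calc g * c = b₁⁻¹ * (b₂ * c * b₁⁻¹) * b₁ := by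
                simp only [hg, mul_assoc, inv_mul_cancel, mul_one]
            _ = b₁⁻¹ * (b₁ * a') * b₁ := by rw [← he]
            _ = a' * b₁ := by rw [← mul_assoc, inv_mul_cancel, one_mul]
        rw [this]
        exact hright (mem_image_of_mem _ ha')
      have hinj : Function.Injective (fun c : G => b₂ * c * b₁⁻¹) := by
        intro c₁ c₂ he
        have := mul_right_cancel he
        exact mul_left_cancel this
      rw [← card_image_of_injective (B ^ m) (mul_right_injective b₁),
        ← card_image_of_injective S' hinj, ← card_union_of_disjoint hdisj]
      refine card_le_card (union_subset hleft fun z hz => ?_)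
      obtain ⟨c, hc, rfl⟩ := mem_image.1 hz
      rw [hS', mem_filter] at hc
      obtain ⟨a, ha, rfl⟩ := mem_image.1 hc.2
      rw [show b₂ * (a * b₁) * b₁⁻¹ = b₂ * a by simp only [mul_assoc, mul_inv_cancel, mul_one],
        ← hCdef']
      exact mul_mem_mul hb₂ ha
    omega

/-- **Olson 1984, Theorem 6**, as printed: `n ≥ 2 ⇒ |Bⁿ| = |Bⁿ⁺¹| ∨ 2|Bⁿ⁻¹| + |B| ≤ 2|Bⁿ|`.
[cite: Olson1984, Thm 6] -/
@[to_additive /-- Additive-notation version (Olson writes his groups additively; statement and sources as for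
the multiplicative declaration, Olson 1984). -/]
theorem card_pow_eq_or_card_le' (B : Finset G) {n : ℕ} (hn : 2 ≤ n) :
    #(B ^ n) = #(B ^ (n + 1)) ∨ 2 * #(B ^ (n - 1)) + #B ≤ 2 * #(B ^ n) := by
  obtain ⟨m, rfl⟩ : ∃ m, n = m + 1 := ⟨n - 1, by omega⟩
  have := card_pow_eq_or_card_le B m (by omega)
  simpa using this

end Olson

end Literature.Combinatorics.Additive
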